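import Literature.Analysis.FluidPDE.GalerkinSmoothLimitODE
import HarnessLib

/-!
# Smooth short-time solutions by the Fourier–Galerkin energy method, V: time derivatives of all
# orders of the limit (Fourier-side coefficient families)

Analysis/FluidPDE proof file (theorems only), sequel of `GalerkinSmoothLimitODE.lean`. The limit
coefficient curve `c` of the damped Galerkin systems solves, mode by mode within `[0, T]`,
`∂ₜc_k = -ν4π²|k|²c_k + Π_k(-σ_k c_k - N(c)_k)` (part IV). This file runs the **bootstrap of time
derivatives** on the Fourier side, exactly as the tree does for the scalar transport equation
(`ScalarFourier.PicardHyp.exists_coeffFamily`, `ScalarFourierTimeRegularity.lean`): the candidate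
for `∂ₜⁱ⁺¹c` is the `i`-th member of the right-hand-side family built from `W₀ = c, …, Wᵢ` — the
dissipative symbol `-(ν4π²|k|² + σ_k)` (at most quadratic growth), and, component by component, the
Leray matrix `δ_{lp} - k_lk_p/|k|²` (bounded symbols) applied to the Leibniz-expanded transport
families `ScalarFourier.transportFamily` of the components (the drift families being the
components of `W` itself) — and the closure properties of `ScalarFourier.IsCoeffFamily`
(`.symbol`, `.transportFamily`, `.finset_sum`, `.sub`) give decay, continuity and
`∂ₜWᵢ = Wᵢ₊₁` within `[0, T]`. At order zero the equation of part IV is used together with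
`Π_k c_k = c_k` (`c` is divergence free).

* `leraySym_apply`, `norm_lerayEntry_le` — the Leray multiplier component by component;
* `exists_vectorCoeffFamily` — **for every `n`, a vector family `W₀ = c, …, W_n` all of whose
  components are coefficient families of order `n` on `[0,T]`** (Majda–Bertozzi 2002, Thm. 3.5 and
  the remark after (3.79): the solution is as regular as the data allow; Leray 1934, pp. 220–221,
  for the Navier–Stokes twin in the tree, `FourierNS.PicardHyp.exists_family`).

With `ScalarFourier.isSmoothSpaceTimeOn_torusSynth` this yields joint smoothness of the
synthesized velocity on `[0, T] × T^d` (next file).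

## References

* A. J. Majda, A. L. Bertozzi, *Vorticity and Incompressible Flow*, CUP 2002, §3.2, Thm. 3.4,
  Thm. 3.5, (3.79). [`MajdaBertozziCUP2002`]
* N. V. Krylov, *Lectures on Elliptic and Parabolic Equations in Hölder Spaces*, AMS 1996,
  Thm. 8.12.1, Ex. 8.12.4 (time regularity up to `t = 0`). [`Krylov1996`]
-/

noncomputable section

open MeasureTheory Set Filter Topology Function UnitAddTorus Metric
open scoped ENNReal NNReal InnerProductSpace ContDiff

namespace Literature.Analysis.FluidPDE

namespace GalerkinSmooth

open FunctionSpaces FunctionSpaces.Torus Torus EulerGalerkin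
open FourierNS (HasDecay)
open ScalarFourier (lconv dsym transportSym transportFamily latOrder latMass IsCoeffFamily consFamily)

variable {d : Type*} [Fintype d] [DecidableEq d]

/-! ## The Leray multiplier, component by component -/

section Leray

/-- Components of the Leray multiplier: `(Π_k v)_l = ∑_p (δ_{lp} - k_l k_p/|k|²) v_p`. [folklore] -/
theorem leraySym_apply (k : d → ℤ) (v : EuclideanSpace ℂ d) (l : d) :
    leraySym k v l = ∑ p, ((if l = p then (1 : ℂ) else 0) - (k l : ℂ) * (k p : ℂ) / ((freqNormSq k : ℝ) : ℂ)) * v p := by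
  classical
  rw [leraySym_def]
  simp only [PiLp.sub_apply, PiLp.smul_apply, freqVec_apply, smul_eq_mul, sub_mul, Finset.sum_sub_distrib]
  congr 1
  · simp only [ite_mul, one_mul, zero_mul, Finset.sum_ite_eq, Finset.mem_univ, if_true]
  · rw [div_mul_eq_mul_div, Finset.sum_mul, Finset.sum_div]
    refine Finset.sum_congr rfl fun p _ => ?_
    ring

/-- The entries of the Leray multiplier are bounded by `2`. [folklore] -/
theorem norm_lerayEntry_le (k : d → ℤ) (l p : d) :
    ‖((if l = p then (1 : ℂ) else 0) - (k l : ℂ) * (k p : ℂ) / ((freqNormSq k : ℝ) : ℂ))‖ ≤ 2 * (1 + ‖k‖) ^ 0 := by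
  rw [pow_zero, mul_one]
  have h1 : ‖(if l = p then (1 : ℂ) else 0)‖ ≤ 1 := by split_ifs <;> simp
  have h2 : ‖(k l : ℂ) * (k p : ℂ) / ((freqNormSq k : ℝ) : ℂ)‖ ≤ 1 := by
    rw [norm_div, norm_mul, Complex.norm_intCast, Complex.norm_intCast, Complex.norm_real,
      Real.norm_of_nonneg (freqNormSq_nonneg k)]
    by_cases h0 : freqNormSq k = 0
    · rw [h0, div_zero]; exact zero_le_one
    · rw [div_le_one (lt_of_le_of_ne (freqNormSq_nonneg k) (Ne.symm h0))]
      have hl : |(k l : ℝ)| ^ 2 ≤ freqNormSq k := by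
        rw [sq_abs]; exact Finset.single_le_sum (f := fun i => ((k i : ℝ)) ^ 2) (fun _ _ => sq_nonneg _) (Finset.mem_univ l)
      have hp : |(k p : ℝ)| ^ 2 ≤ freqNormSq k := by
        rw [sq_abs]; exact Finset.single_le_sum (f := fun i => ((k i : ℝ)) ^ 2) (fun _ _ => sq_nonneg _) (Finset.mem_univ p)
      nlinarith [abs_nonneg (k l : ℝ), abs_nonneg (k p : ℝ), sq_nonneg (|(k l : ℝ)| - |(k p : ℝ)|)]
  linarith [norm_sub_le (if l = p then (1 : ℂ) else 0) ((k l : ℂ) * (k p : ℂ) / ((freqNormSq k : ℝ) : ℂ))]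

end Leray

/-! ## Coefficient families of all orders for the Galerkin limit -/

section Families

variable {ν : ℝ} {σ : (d → ℤ) → ℝ} {T : ℝ} {c : ℝ → (d → ℤ) → EuclideanSpace ℂ d}

/-- **Time derivatives of all orders of the Galerkin limit, on the Fourier side** (the bootstrap
`Wᵢ₊₁ := ∂ₜWᵢ` through the equation, as `ScalarFourier.PicardHyp.exists_coeffFamily` for the
scalar transport equation; Majda–Bertozzi 2002, Thm. 3.5 and the remark after (3.79): the solution
is as smooth in time as the equation allows; here every order, the datum being smooth). Let
`c : [0,T] → (ℤ^d → ℂ^d)` be divergence free, continuous at each mode, with every weighted sup-norm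
decay uniformly on `[0,T]`, and solve mode by mode within `[0,T]`
`∂ₜc_k = -ν4π²|k|²c_k + Π_k(-σ_k c_k - N(c)_k)` with a damping symbol of at most quadratic growth.
Then for every `n` there is a vector family `W₀ = c, W₁, …, W_n` all of whose components are
coefficient families of order `n` on `[0,T]` (`ScalarFourier.IsCoeffFamily`: `∂ₜWᵢ = Wᵢ₊₁` within
`[0,T]` at each mode, every decay, continuity). [cite: MajdaBertozziCUP2002, Thm. 3.4–3.5, (3.79)] -/
theorem exists_vectorCoeffFamily (hT : 0 < T) (hν : 0 ≤ ν) (hσ : ∀ k, 0 ≤ σ k) {Mσ : ℝ} (hMσ : 0 ≤ Mσ)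
    (hσg : ∀ k, σ k ≤ Mσ * (1 + ‖k‖) ^ 2)
    (hdec : ∀ K : ℕ, ∃ C : ℝ, ∀ t ∈ Icc 0 T, HasDecay K C (c t))
    (hcont : ∀ k, ContinuousOn (fun t => c t k) (Icc 0 T))
    (htrans : ∀ t ∈ Icc 0 T, ∀ k : d → ℤ, ∑ j, (k j : ℂ) * c t k j = 0)
    (hode : ∀ k, ∀ t ∈ Icc 0 T, HasDerivWithinAt (fun s => c s k)
      (-((((ν * (4 * Real.pi ^ 2 * freqNormSq k)) : ℝ) : ℂ) • c t k) +
        leraySym k (-((((σ k) : ℝ)) : ℂ) • c t k -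
          WithLp.toLp 2 (fun p => transportSym (fun j m => c t m j) (fun m => c t m p) k))) (Icc 0 T) t)
    (n : ℕ) :
    ∃ W : ℕ → ℝ → (d → ℤ) → EuclideanSpace ℂ d, W 0 = c ∧ ∀ l, IsCoeffFamily T n (fun i t m => W i t m l) := by
  -- the base family
  have base : ∀ l, IsCoeffFamily T 0 (fun _ t m => c t m l) := fun l =>
    { decay := fun i _ K => by
        obtain ⟨C, hC⟩ := hdec K
        exact ⟨C, fun t ht => hasDecay_apply (hC t ht) l⟩
      cont := fun i _ m => (PiLp.continuous_apply 2 _ l).comp_continuousOn (hcont m)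
      deriv := fun i hi => absurd hi (Nat.not_lt_zero i) }
  -- the right-hand side family of a vector family, component `l`
  set D : (ℕ → ℝ → (d → ℤ) → EuclideanSpace ℂ d) → d → ℕ → ℝ → (d → ℤ) → ℂ := fun W l i t k =>
    -((((ν * (4 * Real.pi ^ 2 * freqNormSq k) + σ k) : ℝ) : ℂ)) * W i t k l -
      ∑ p, ((if l = p then (1 : ℂ) else 0) - (k l : ℂ) * (k p : ℂ) / ((freqNormSq k : ℝ) : ℂ)) *
        transportFamily (fun j i' t' m => W i' t' m j) (fun i' t' m => W i' t' m p) i t k with hD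
  have hDfam : ∀ {n : ℕ} (W : ℕ → ℝ → (d → ℤ) → EuclideanSpace ℂ d),
      (∀ l, IsCoeffFamily T n (fun i t m => W i t m l)) → ∀ l, IsCoeffFamily T n (D W l) := by
    intro n W hW l
    have hlin : IsCoeffFamily T n (fun i t k => -((((ν * (4 * Real.pi ^ 2 * freqNormSq k) + σ k) : ℝ) : ℂ)) * W i t k l) := by
      refine (hW l).symbol (g := 2) (M := 4 * Real.pi ^ 2 * ν * Fintype.card d + Mσ) (by positivity) fun k => ?_
      rw [norm_neg, Complex.norm_real, Real.norm_of_nonneg (add_nonneg (mul_nonneg hν (mul_nonneg (by positivity)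
        (freqNormSq_nonneg k))) (hσ k))]
      have h1 := ScalarFourier.freqNormSq_le_card_mul k
      have h2 : ‖k‖ ^ 2 ≤ (1 + ‖k‖) ^ 2 := by nlinarith [norm_nonneg k]
      have hc : (0 : ℝ) ≤ Fintype.card d := Nat.cast_nonneg _
      have h3 : ν * (4 * Real.pi ^ 2 * freqNormSq k) ≤ 4 * Real.pi ^ 2 * ν * Fintype.card d * (1 + ‖k‖) ^ 2 := by
        calc ν * (4 * Real.pi ^ 2 * freqNormSq k) ≤ ν * (4 * Real.pi ^ 2 * (Fintype.card d * ‖k‖ ^ 2)) := by gcongr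
          _ ≤ ν * (4 * Real.pi ^ 2 * (Fintype.card d * (1 + ‖k‖) ^ 2)) := by gcongr
          _ = 4 * Real.pi ^ 2 * ν * Fintype.card d * (1 + ‖k‖) ^ 2 := by ring
      nlinarith [hσg k, h3]
    have htr : ∀ p, IsCoeffFamily T n (transportFamily (fun j i' t' m => W i' t' m j) (fun i' t' m => W i' t' m p)) :=
      fun p => (hW p).transportFamily hT (fun j => hW j)
    have hsum : IsCoeffFamily T n (fun i t k => ∑ p, ((if l = p then (1 : ℂ) else 0) - (k l : ℂ) * (k p : ℂ) /
        ((freqNormSq k : ℝ) : ℂ)) * transportFamily (fun j i' t' m => W i' t' m j) (fun i' t' m => W i' t' m p) i t k) :=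
      IsCoeffFamily.finset_sum _ fun p _ => (htr p).symbol (g := 0) (M := 2) (by norm_num) (fun m => norm_lerayEntry_le m l p)
    exact hlin.sub hsum
  -- the induction
  induction n with
  | zero => exact ⟨fun _ => c, rfl, fun l => base l⟩
  | succ n ih =>
    obtain ⟨W, hW0, hW⟩ := ih
    have hDf := hDfam W hW
    set W' : ℕ → ℝ → (d → ℤ) → EuclideanSpace ℂ d := fun i =>
      if i = 0 then c else fun t k => WithLp.toLp 2 (fun l => D W l (i - 1) t k) with hW'
    have hW'0 : W' 0 = c := by simp [hW']
    have hcomp0 : ∀ t m l, W' 0 t m l = c t m l := fun t m l => by rw [hW'0]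
    have hcompS : ∀ i t m l, W' (i + 1) t m l = D W l i t m := fun i t m l => by
      simp [hW']
    refine ⟨W', hW'0, fun l => ⟨fun i hi K => ?_, fun i hi m => ?_, fun i hi m t ht => ?_⟩⟩
    · cases i with
      | zero => simpa only [hcomp0] using (base l).decay 0 le_rfl K
      | succ i => simpa only [hcompS] using (hDf l).decay i (by omega) K
    · cases i with
      | zero => simpa only [hcomp0] using (base l).cont 0 le_rfl m
      | succ i => simpa only [hcompS] using (hDf l).cont i (by omega) m
    · cases i with
      | zero =>
        have hgoal : HasDerivWithinAt (fun s => c s m l) (D W l 0 t m) (Icc 0 T) t := by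
          have hd := ((EuclideanSpace.proj (𝕜 := ℂ) (ι := d) l).restrictScalars ℝ).hasFDerivAt.comp_hasDerivWithinAt t
            (hode m t ht)
          have hval : (-((((ν * (4 * Real.pi ^ 2 * freqNormSq m)) : ℝ) : ℂ) • c t m) +
              leraySym m (-((((σ m) : ℝ)) : ℂ) • c t m -
                WithLp.toLp 2 (fun p => transportSym (fun j m' => c t m' j) (fun m' => c t m' p) m))) l = D W l 0 t m := by
            rw [PiLp.add_apply, PiLp.neg_apply, PiLp.smul_apply, smul_eq_mul, leraySym_sub,
              PiLp.sub_apply, leraySym_smul, PiLp.smul_apply, leraySym_of_transversal (htrans t ht m), smul_eq_mul,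
              leraySym_apply]
            simp only [hD, ScalarFourier.transportFamily_zero, hW0]
            push_cast
            ring
          rw [← hval]
          exact hd
        simpa only [hcomp0, hcompS] using hgoal
      | succ i =>
        simpa only [hcompS] using (hDf l).deriv i (by omega) m t ht

end Families

end GalerkinSmooth

end Literature.Analysis.FluidPDE
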